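import Summits.ValiantsHypothesis.ValiantsHypothesis.Theorems.LacunarySymmetroidMatrixDescartesCensusV19CSoundNineteen
import Summits.ValiantsHypothesis.ValiantsHypothesis.Theorems.LacunarySymmetroidMatrixDescartesCensusV20SoundCoverX
import Summits.ValiantsHypothesis.ValiantsHypothesis.Theorems.LacunarySymmetroidMatrixDescartesCensusSidonBoxKit

/-!
# `MatrixDescartes` census — soundness of the CASE-C cover check (`V19C.coverSlicesX`) and the transport from sorted supports to exponent windows

HONEST FRAMING.  Object-search cell `pub-symmetroid`; door-A item `DoorA26 = PosRootLawAt 2 6 19`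
(stmt-ValiantsHypothesis-19979; OPEN, typed, never asserted) and its sharper support rows `PosRootLawOn 2 6 18 d`.  Soundness of the Boolean cover
check of `…CensusV19CCheck`: if a slice plan exhausts the tops of a box (`V20.planCoversR`), every slice passes `V19C.coverSlicesX exc keys`, and every
key carries the row `PosRootLawOn 2 6 18`, then every SORTED support `0 = d₀ < ⋯ < d₅` of the box with exactly `20` distinct pair sums that is not
in the exception list carries it (mirrors by `Census.posRootLawOn_iff_mirror_rev`); plus the transport to arbitrary exponent vectors in a window
(sorting, translation), with the count `#pairSums ≤ 15` for a repeated exponent.  Nothing here bears on the `2`-Sidon supports, on `ζ_sym(2,6)`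
over all supports, on `MatrixDescartes` (stmt-ValiantsHypothesis-18050) or on `VP ≠ VNP`.

[folklore] Bookkeeping; elementary.
-/

-- the D-0017 layout repeats a namespace component (single-conjunct summit); the `dupNamespace` linter flags it; name mandated.
set_option linter.dupNamespace false

namespace Summit.ValiantsHypothesis.ValiantsHypothesis.Theorems.LacunarySymmetroidMatrixDescartes.Census.V19C

open V20 (Atom allAtoms psum cA psums6 mirror incLists keysTop planCoversR freshIn_iff mem_incLists_three mirror_six psum_cA cA_mem
  mem_allAtoms_iff)
open Summit.ValiantsHypothesis.ValiantsHypothesis.Theorems.MatrixDescartes.Negative (PosRootLawAt)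

section Cover

open Finset

/-! ### `oneColl` and the number of distinct pair sums -/

/-- `countDistinct` counts the distinct entries. [folklore] -/
theorem countDistinct_eq : ∀ l : List ℕ, countDistinct l = l.toFinset.card
  | [] => by simp [countDistinct]
  | a :: l => by
    rw [countDistinct, countDistinct_eq l, List.toFinset_cons]
    by_cases h : a ∈ l
    · have hf : V20.freshIn a l = false := by
        cases hfa : V20.freshIn a l
        · rfl
        · exact absurd h ((freshIn_iff a l).1 hfa)
      rw [hf, Finset.insert_eq_of_mem (List.mem_toFinset.2 h)]; rfl
    · rw [(freshIn_iff a l).2 h, if_pos rfl, Finset.card_insert_of_notMem (fun h' => h (List.mem_toFinset.1 h'))]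

/-- The pair sums of a six-element support, as the `psums6` list, fill exactly the pair-sum table. [folklore] -/
theorem toFinset_psums6 (d : Fin 6 → ℕ) :
    (psums6 [d 0, d 1, d 2, d 3, d 4, d 5]).toFinset = (Finset.univ : Finset (Fin 6 × Fin 6)).image (fun p => d p.1 + d p.2) := by
  set dl : List ℕ := [d 0, d 1, d 2, d 3, d 4, d 5] with hdl
  have hps : psums6 dl = allAtoms.map (psum dl) := by rw [hdl]; rfl
  have hget : ∀ i : Fin 6, d i = dl.getD i.val 0 := by intro i; fin_cases i <;> rfl
  rw [hps]
  ext e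
  rw [List.mem_toFinset, List.mem_map, Finset.mem_image]
  constructor
  · rintro ⟨a, ha, rfl⟩
    obtain ⟨i, j⟩ := a
    obtain ⟨hij, hj⟩ : i ≤ j ∧ j < 6 := (mem_allAtoms_iff _).1 ha
    have hi : i < 6 := by omega
    refine ⟨(⟨i, hi⟩, ⟨j, hj⟩), Finset.mem_univ _, ?_⟩
    rw [hget, hget]; rfl
  · rintro ⟨p, -, rfl⟩
    exact ⟨cA p.1.val p.2.val, cA_mem p.1.isLt p.2.isLt, by rw [psum_cA, ← hget, ← hget]⟩

/-- A support with exactly `20` distinct pair sums passes `oneColl`. [folklore] -/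
theorem oneColl_of_card_eq (d : Fin 6 → ℕ)
    (h20 : ((Finset.univ : Finset (Fin 6 × Fin 6)).image (fun p => d p.1 + d p.2)).card = 20) :
    oneColl [d 0, d 1, d 2, d 3, d 4, d 5] = true := by
  unfold oneColl
  rw [countDistinct_eq, toFinset_psums6, h20]
  rfl

/-! ### Soundness of the cover by slices with an exception list -/

/-- **Soundness of the Case-C cover check.**  If the slice plan exhausts the tops `lo ≤ f ≤ N`, every slice passes `coverSlicesX exc keys`, and every
key carries `PosRootLawOn 2 6 18`, then so does every sorted support of the box with exactly `20` distinct pair sums outside `exc`. [folklore] -/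
theorem box_of_planX (lo N : ℕ) (P : List (ℕ × ℕ × ℕ)) (exc keys : List (List ℕ)) (hplan : planCoversR lo N P = true)
    (hslices : coverSlicesX exc keys P = true) (hkeys : ∀ dl ∈ keys, PosRootLawOn 2 6 18 (fun i => dl.getD i 0))
    (d : Fin 6 → ℕ) (hd : StrictMono d) (h0 : d 0 = 0) (hlo : lo ≤ d 5) (hN : d 5 ≤ N)
    (h20 : ((Finset.univ : Finset (Fin 6 × Fin 6)).image (fun p => d p.1 + d p.2)).card = 20)
    (hexc : [d 0, d 1, d 2, d 3, d 4, d 5] ∉ exc) : PosRootLawOn 2 6 18 d := by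
  have hdf : (fun i : Fin 6 => [d 0, d 1, d 2, d 3, d 4, d 5].getD i 0) = d := by
    funext i; fin_cases i <;> rfl
  have h45 := hd (show (4 : Fin 6) < 5 by decide)
  have h34 := hd (show (3 : Fin 6) < 4 by decide)
  have h23 := hd (show (2 : Fin 6) < 3 by decide)
  have h12 := hd (show (1 : Fin 6) < 2 by decide)
  have h01 := hd (show (0 : Fin 6) < 1 by decide)
  unfold V20.planCoversR at hplan
  rw [List.all_eq_true] at hplan
  have hf := hplan (d 5) (List.mem_range'_1.2 ⟨hlo, by omega⟩)
  rw [List.all_eq_true] at hf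
  have he := hf (d 4) (List.mem_range.2 h45)
  have h4 : Nat.ble 4 (d 4) = true := by simp only [Nat.ble_eq]; omega
  rw [h4, Bool.not_true, Bool.false_or, List.any_eq_true] at he
  obtain ⟨s, hs, hsb⟩ := he
  simp only [Bool.and_eq_true, beq_iff_eq, Nat.ble_eq] at hsb
  obtain ⟨⟨hs1, hs2⟩, hs3⟩ := hsb
  unfold coverSlicesX at hslices
  rw [List.all_eq_true] at hslices
  have hsl := hslices s hs
  unfold coverSliceX at hsl
  rw [List.all_eq_true] at hsl
  have hrw := hsl (d 4) (List.mem_range'_1.2 ⟨hs2, by omega⟩)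
  unfold coverRowX at hrw
  rw [List.all_eq_true] at hrw
  have h := hrw _ (mem_incLists_three d hd h0)
  unfold coverCellX at h
  rw [hs1] at h
  have hl : (0 :: ([d 1, d 2, d 3] ++ [d 4, d 5])) = [d 0, d 1, d 2, d 3, d 4, d 5] := by rw [h0]; rfl
  rw [hl, oneColl_of_card_eq d h20] at h
  simp only [Bool.not_true, Bool.false_or, Bool.or_eq_true] at h
  rcases h with (hx | hk) | hm
  · exact absurd (List.elem_iff.1 hx) hexc
  · rw [← hdf]
    exact hkeys _ (List.mem_of_mem_filter (List.mem_of_mem_filter (List.elem_iff.1 hk)))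
  · have hrow := hkeys _ (List.mem_of_mem_filter (List.mem_of_mem_filter (List.elem_iff.1 hm)))
    rw [mirror_six] at hrow
    exact (posRootLawOn_iff_mirror_rev d (d 5) (fun l => hd.monotone (Fin.le_last l))).2 hrow

/-! ### Transport: sorted supports of a box ⇒ exponent vectors in a window -/

/-- A repeated exponent leaves at most `15` distinct pair sums (sharper form of `Census.card_pairSums_le_of_not_injective`). [folklore] -/
theorem card_pairSums_le_fifteen_of_not_injective (d : Fin 6 → ℕ) (hd : ¬ Function.Injective d) :
    ((Finset.univ : Finset (Fin 6 × Fin 6)).image (fun p => d p.1 + d p.2)).card ≤ 15 := by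
  classical
  set T : Finset ℕ := Finset.univ.image d with hT
  have hTcard : T.card ≤ 5 := by
    have h6 : T.card ≤ (Finset.univ : Finset (Fin 6)).card := Finset.card_image_le
    have hne : T.card ≠ (Finset.univ : Finset (Fin 6)).card := by
      intro heq
      apply hd
      have hinj : Set.InjOn d ↑(Finset.univ : Finset (Fin 6)) := Finset.card_image_iff.mp heq
      exact Set.injOn_univ.mp (by simpa using hinj)
    simp only [Finset.card_univ, Fintype.card_fin] at h6 hne
    omega
  have hsub : (Finset.univ : Finset (Fin 6 × Fin 6)).image (fun p => d p.1 + d p.2)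
      ⊆ ((T ×ˢ T).filter (fun q : ℕ × ℕ => q.1 ≤ q.2)).image (fun q => q.1 + q.2) := by
    intro x hx
    simp only [Finset.mem_image, Finset.mem_univ, true_and, Finset.mem_filter, Finset.mem_product, hT] at hx ⊢
    obtain ⟨p, rfl⟩ := hx
    rcases le_total (d p.1) (d p.2) with h | h
    · exact ⟨(d p.1, d p.2), ⟨⟨⟨p.1, rfl⟩, ⟨p.2, rfl⟩⟩, h⟩, rfl⟩
    · exact ⟨(d p.2, d p.1), ⟨⟨⟨p.2, rfl⟩, ⟨p.1, rfl⟩⟩, h⟩, add_comm _ _⟩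
  have htri := two_mul_card_filter_le_sq T
  have h30 : T.card * (T.card + 1) ≤ 5 * 6 := Nat.mul_le_mul hTcard (by omega)
  have := (Finset.card_le_card hsub).trans Finset.card_image_le
  omega

/-- **Transport with exceptions for the one-collision class.**  If the row `PosRootLawOn 2 6 B` holds on every sorted support
`0 = e₀ < ⋯ < e₅ ≤ N` with exactly `20` distinct pair sums outside the list `EX`, then it holds on every exponent vector `d` in a window of
width `N` with exactly `20` distinct pair sums, unless a re-indexed translate of `d` is in `EX`. [folklore] -/
theorem posRootLawOn_box_of_sorted_except20 (B N : ℕ) (EX : List (Fin 6 → ℕ))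
    (hsorted : ∀ e : Fin 6 → ℕ, StrictMono e → e 0 = 0 → e 5 ≤ N →
      ((Finset.univ : Finset (Fin 6 × Fin 6)).image (fun p => e p.1 + e p.2)).card = 20 → e ∉ EX → PosRootLawOn 2 6 B e)
    (d : Fin 6 → ℕ) (hw : ∀ i j, d i ≤ d j + N)
    (h20 : ((Finset.univ : Finset (Fin 6 × Fin 6)).image (fun p => d p.1 + d p.2)).card = 20)
    (hex : ∀ v ∈ EX, ∀ (σ : Equiv.Perm (Fin 6)) (c : ℕ), (d ∘ σ) ≠ fun l => v l + c) :
    PosRootLawOn 2 6 B d := by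
  classical
  have hinj : Function.Injective d := by
    by_contra hni
    have := card_pairSums_le_fifteen_of_not_injective d hni
    omega
  set σ := Tuple.sort d with hσ
  have hmono : Monotone (d ∘ σ) := Tuple.monotone_sort d
  have hsm : StrictMono (d ∘ σ) := hmono.strictMono_of_injective (hinj.comp σ.injective)
  set m := (d ∘ σ) 0 with hm
  have hmle : ∀ l, m ≤ (d ∘ σ) l := fun l => hmono (Fin.zero_le l)
  set e : Fin 6 → ℕ := fun l => (d ∘ σ) l - m with he
  have hde : (d ∘ σ) = fun l => e l + m := by
    funext l; simp only [he]; have := hmle l; omega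
  have he_mono : StrictMono e := by
    intro a b hab; simp only [he]; have := hsm hab; have := hmle a; omega
  have he0 : e 0 = 0 := by simp [he, hm]
  have he5 : e 5 ≤ N := by
    simp only [he]
    have := hw (σ 5) (σ 0)
    simp only [hm, Function.comp] at this ⊢
    omega
  have h20e : ((Finset.univ : Finset (Fin 6 × Fin 6)).image (fun p => e p.1 + e p.2)).card = 20 := by
    have h1 := card_pairSums_comp_equiv σ d
    rw [hde] at h1
    rw [← card_pairSums_add_const e m, h1]; exact h20
  have hexe : e ∉ EX := fun hmem => hex e hmem σ m hde
  have hrow : PosRootLawOn 2 6 B e := hsorted e he_mono he0 he5 h20e hexe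
  have hrow' : PosRootLawOn 2 6 B (d ∘ σ) := by
    rw [hde]; exact (posRootLawOn_add_const_iff e m).mpr hrow
  exact (posRootLawOn_comp_equiv_iff σ d).mpr hrow'

end Cover

end Summit.ValiantsHypothesis.ValiantsHypothesis.Theorems.LacunarySymmetroidMatrixDescartes.Census.V19C
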